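import Summits.Ventures.AbcSig.Rows.StatementsC1b
import Summits.Ventures.AbcSig.Rows.XnA7Yn59Z2X

/-!
# Venture AbcSig — CELL bridge for `xⁿ + 2^α yⁿ = 59 z²` (`7 ≤ α < n`): p1's census predicate `Rows.C1bCell 59 Rows.AlphaGe7Reduced 11 {11}`

HONEST FRAMING. COMPUTATION cell `pub-abcsig`; CONDITIONAL theorem; no claim on ABC or any summit. Hypotheses exactly
those of `Rows/XnA7Yn59Z2X.lean` (`xrow_XnA7Yn59Z2`): `BS04Package` (CITED), `DataComplete` / `RefinesCPSymAll` (COMPUTED,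
certified engine level files; norm-form certificates `Sieve/CharpolyCert.lean`), and the row's per-orbit CITED exclusions
`hX_…` universally quantified in the exponent. Conclusion = p1's statement of the SIGNED row of record
`census/rows/C1b/C1b-C59-a7plus.md` (sha16 `78ffcbeffc61e853`) in the census vocabulary
(`Rows/Statements.lean`, `Rows/StatementsC1b.lean`). GENERATED by p-lean g4 `gen4/cprow.py` (pattern of `Rows/XnYn14Z2XCell.lean`).
-/

namespace Summit.Ventures.AbcSig

/-- `xⁿ + 2^α yⁿ = 59 z²` (`7 ≤ α < n`): p1's `Rows.C1bCell 59 Rows.AlphaGe7Reduced 11 {11}` from `xrow_XnA7Yn59Z2` (hypotheses as there, `hX_…` for every exponent). -/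
theorem C1bCell_59_a7plus_of (M : NewformModel) (hP : M.BS04Package)
    (hD6962 : M.DataComplete 6962 level6962Orbits) (hCP6962 : M.RefinesCPSymAll 6962 level6962CP)
    (hX_orbit_6962_37 : ∀ n : ℕ, n ∈ ([29] : List ℕ) → M.Excludes 6962 orbit_6962_37 (famBCge7 59 n))
    (hX_orbit_6962_38 : ∀ n : ℕ, n ∈ ([29] : List ℕ) → M.Excludes 6962 orbit_6962_38 (famBCge7 59 n)) :
    Rows.C1bCell 59 Rows.AlphaGe7Reduced 11 {11} := by
  intro n hn h11 hC hR α hα x y z h1 h2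
  exact xrow_XnA7Yn59Z2 M hP hD6962 hCP6962 n hn h11 (by
      intro hmem
      simp only [List.mem_cons, List.not_mem_nil, or_false] at hmem
      subst hmem
      simp at hR) hC α hα.1 hα.2 (hX_orbit_6962_37 n) (hX_orbit_6962_38 n) x y z h1 h2

end Summit.Ventures.AbcSig
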